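import Mathlib
import HarnessLib
import Summits.NavierStokesRegularity.NavierStokesRegularity.Theorems.UnthreadedRigidityDoorUnthreadedRigidityTwoShellSphereCoefficients
import Summits.NavierStokesRegularity.NavierStokesRegularity.Theorems.UnthreadedRigidityDoorUnthreadedRigidityTwoShellSphereRelation
import Summits.NavierStokesRegularity.NavierStokesRegularity.Theorems.UnthreadedRigidityDoorUnthreadedRigidityMixedPairTwoShellWindowRigidity

/-!
# Route `UnthreadedRigidityDoor`, item `UnthreadedRigidity` (W2, stmt-NavierStokesRegularity-27585) — LINE g12-1 «CO-ZONAL» rung family: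
# ★★ `TwoShellWindowRigidity l₁ l₂` HOLDS FOR EVERY OPPOSITE-PARITY PAIR OF DEGREES WITH `|l₁ − l₂| ≥ 2` (hence `≥ 3`) — such two-shell windows are EMPTY

Prover file (engine-1 g74; `--supports stmt-NavierStokesRegularity-27585 --as helper`; route-independent imports).

The persistence road of HOME engine/engine-1/RECORD-OF-CUSTODY-engine1-g73.md §3(a)/§4 (tripwire), completed for all opposite-parity degree
pairs except the consecutive ones: in a bounded mild window whose slices are two-shells `twoShellL (H₁ t) (H₂ t) Y₁ Y₂ x₀` over fixed nonzero
solid harmonics of degrees `l₁` odd, `l₂` even (either order of size) with admissible profiles,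
* every slice is toroidally balanced with radial coefficients (bridge M for two shells, `twoShell_window_toroidal_balance`, p727992);
* hence on every sphere `−K₁α₁ r^{2l₁−2}|∇Y₁|² + b₁r^{2l₁}Y₁² − K₂α₂ r^{2l₂−2}|∇Y₂|² + b₂ r^{2l₂} Y₂² − e r^{l₂} Y₂ = C` (`twoShell_sphere_relation`,
  p728179);
* by the TWO-SHELL SPHERE COEFFICIENTS (`twoShell_sphere_coefficients`, from the top-component lemmas (T1)/(T2) in the null-cone chart
  currency) the TOP-degree shell has `b_T ≡ 0` and `K_T α_T ≡ 0` on `(0,∞)` as soon as the degrees differ by at least two;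
* the profiles of a two-shell window are analytic on `(0,∞)` (parity read-off along a ray, `analyticOnNhd_twoShellProfile_odd/even`, from
  `VirialHorn.window_analyticOnNhd_slice`), so `Persistence.amplitudeVanishing` (p710551) makes the top profile NULL: the slices are single
  shells over the other (nonzero) harmonic, and `Persistence.singleShellWindowVanishes` (every degree) makes the window vanish identically;
  the zero window is infinitesimally axisymmetric (`VirialHorn.exists_skew_ne_zero`).
Results: `analyticOnNhd_twoShellProfile_odd`, `analyticOnNhd_twoShellProfile_even`, ★ `twoShell_window_vanishes_of_gap`,
★★ `twoShellWindowRigidity_of_gap : … → TwoShellWindowRigidity l₁ l₂` for all `l₁ ≠ l₂ (mod 2)`, `1 ≤ l₁, l₂`, `l₁ + 2 ≤ l₂ ∨ l₂ + 2 ≤ l₁`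
(by name: `(1,4)`, `(4,1)`, `(1,6)`, `(2,5)`, `(3,6)`), and the residual `linkedPairWindowRigidity_of_gap` a fortiori.  What stays OPEN in this family:
the CONSECUTIVE pairs `(l, l+1)` with `l ≥ 2` (the `(1,2)`/`(2,1)` coincidence is the tree theorem p728070 via the cubic law) and the
same-parity pairs.

HONEST LABEL: RUNGS about SPECIAL hypothetical two-shell windows, closed by showing the class is EMPTY; support for `UnthreadedRigidity`
(27585), which stays OPEN with the door Target, W2 and Navier–Stokes regularity; no summit statement is proved.  MODEL/rung work; 0 kit.
-/

noncomputable section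

-- the summit and its single sub-problem share the name (CONVENTIONS §1), as in every Theorems file
set_option linter.dupNamespace false

namespace Summit.NavierStokesRegularity.NavierStokesRegularity.Theorems.UnthreadedRigidity.MixedPair

open Set Function Filter Topology
open scoped RealInnerProductSpace
open Literature.Analysis Literature.Analysis.FluidPDE
open Literature.Analysis.UnboundedOperators (heatExtension)
open Summit.NavierStokesRegularity.NavierStokesRegularity.Theorems.UnthreadedRigidity.ProfileHorn (E3)
open Summit.NavierStokesRegularity.NavierStokesRegularity.Theorems.UnthreadedRigidity.VirialHorn
  (IsSolidHarmonic VirialAdmissible sepShellL vortAmpL strainAmpL exists_skew_ne_zero window_analyticOnNhd_slice)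
open Summit.NavierStokesRegularity.NavierStokesRegularity.Theorems.UnthreadedRigidity.CoZonal (twoShellL TwoShellWindowRigidity
  LinkedPairWindowRigidity)
open Summit.NavierStokesRegularity.NavierStokesRegularity.Theorems.UnthreadedRigidity.ThreadingJets (inner_sepShellL_self)
open Summit.NavierStokesRegularity.NavierStokesRegularity.Theorems.UnthreadedRigidity.Persistence (amplitudeVanishing
  singleShellWindowVanishes sepShellL_null_of_pos)

/-! ## §1 Profiles of an analytic two-shell of opposite parity are analytic off the origin (parity read-off) -/

section ReadOff

variable {l₁ l₂ : ℕ} {Y₁ Y₂ : E3 → ℝ} {H₁ H₂ : ℝ → ℝ} {x₀ : E3}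

/-- the radial read-off of a two-shell: `⟪u(x₀ + y), y⟫ = l₁(l₁+1) H₁(|y|) Y₁(y) + l₂(l₂+1) H₂(|y|) Y₂(y)`. -/
theorem inner_twoShellL_self (hd₁ : 1 ≤ l₁) (hd₂ : 1 ≤ l₂) (hY₁ : IsSolidHarmonic l₁ Y₁) (hY₂ : IsSolidHarmonic l₂ Y₂)
    (hH₁ : VirialAdmissible l₁ H₁) (hH₂ : VirialAdmissible l₂ H₂) (x₀ y : E3) :
    inner ℝ (twoShellL H₁ H₂ Y₁ Y₂ x₀ (x₀ + y)) y =
      ((l₁ : ℝ) * ((l₁ : ℝ) + 1)) * (H₁ ‖y‖ * Y₁ y) + ((l₂ : ℝ) * ((l₂ : ℝ) + 1)) * (H₂ ‖y‖ * Y₂ y) := by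
  show inner ℝ (sepShellL H₁ Y₁ x₀ (x₀ + y) + sepShellL H₂ Y₂ x₀ (x₀ + y)) y = _
  rw [inner_add_left, inner_sepShellL_self hd₁ hY₁ hH₁, inner_sepShellL_self hd₂ hY₂ hH₂]

/-- a unit vector at which a nonzero solid harmonic of degree `≥ 1` does not vanish. -/
theorem exists_unit_ne_zero {l : ℕ} {Y : E3 → ℝ} (hl : 1 ≤ l) (hY : IsSolidHarmonic l Y) (hne : ∃ y, Y y ≠ 0) :
    ∃ e : E3, ‖e‖ = 1 ∧ Y e ≠ 0 := by
  obtain ⟨y, hy⟩ := hne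
  have hy0 : y ≠ 0 := by
    rintro rfl
    have h := hY.apply_smul 0 (0 : E3)
    rw [zero_smul, zero_pow (by omega), zero_mul] at h
    exact hy h
  have hn : 0 < ‖y‖ := norm_pos_iff.2 hy0
  refine ⟨‖y‖⁻¹ • y, by rw [norm_smul, norm_inv, norm_norm, inv_mul_cancel₀ hn.ne'], fun h0 => hy ?_⟩
  have h := hY.apply_smul ‖y‖ (‖y‖⁻¹ • y)
  rw [smul_smul, mul_inv_cancel₀ hn.ne', one_smul, h0, mul_zero] at h
  exact h

/-- ★ THE ODD-DEGREE PROFILE OF AN ANALYTIC TWO-SHELL OF OPPOSITE PARITY IS ANALYTIC on `(0,∞)` (read off along a ray through a point where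
`Y₁ ≠ 0`: the odd part of `r ↦ ⟪u(x₀ + r e), r e⟫` is `2 l₁(l₁+1) r^{l₁} Y₁(e) H₁(r)`). -/
theorem analyticOnNhd_twoShellProfile_odd (hl₁ : Odd l₁) (hl₂ : Even l₂) (hd₁ : 1 ≤ l₁) (hd₂ : 1 ≤ l₂)
    (hY₁ : IsSolidHarmonic l₁ Y₁) (hY₂ : IsSolidHarmonic l₂ Y₂) (hY₁ne : ∃ y, Y₁ y ≠ 0)
    (hH₁ : VirialAdmissible l₁ H₁) (hH₂ : VirialAdmissible l₂ H₂)
    (hu : AnalyticOnNhd ℝ (twoShellL H₁ H₂ Y₁ Y₂ x₀) univ) : AnalyticOnNhd ℝ H₁ (Ioi 0) := by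
  obtain ⟨e, he, hYe⟩ := exists_unit_ne_zero hd₁ hY₁ hY₁ne
  set v : E3 → E3 := twoShellL H₁ H₂ Y₁ Y₂ x₀ with hv
  set φ : ℝ → ℝ := fun r => inner ℝ (v (x₀ + r • e)) (r • e) - inner ℝ (v (x₀ + (-r) • e)) ((-r) • e) with hφ_def
  have hφ : ∀ r : ℝ, AnalyticAt ℝ φ r := fun r =>
    (analyticAt_rayReadOff hu x₀ e r).sub ((analyticAt_rayReadOff hu x₀ e (-r)).comp analyticAt_id.neg)
  have hc : ((l₁ : ℝ) * ((l₁ : ℝ) + 1)) ≠ 0 := by positivity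
  intro r hr
  have hr0 : (0 : ℝ) < r := hr
  have hev : (fun s : ℝ => φ s / (2 * ((l₁ : ℝ) * ((l₁ : ℝ) + 1)) * s ^ l₁ * Y₁ e)) =ᶠ[𝓝 r] H₁ := by
    filter_upwards [Ioi_mem_nhds hr0] with s hs
    have hs0 : (0 : ℝ) < s := hs
    have hn1 : ‖s • e‖ = s := by rw [norm_smul, Real.norm_of_nonneg hs0.le, he, mul_one]
    have hn2 : ‖(-s) • e‖ = s := by rw [norm_smul, Real.norm_eq_abs, abs_neg, abs_of_pos hs0, he, mul_one]
    have hY₁s : Y₁ (s • e) = s ^ l₁ * Y₁ e := hY₁.apply_smul s e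
    have hY₂s : Y₂ (s • e) = s ^ l₂ * Y₂ e := hY₂.apply_smul s e
    have hY₁n : Y₁ ((-s) • e) = -(s ^ l₁ * Y₁ e) := by rw [hY₁.apply_smul, hl₁.neg_pow, neg_mul]
    have hY₂n : Y₂ ((-s) • e) = s ^ l₂ * Y₂ e := by rw [hY₂.apply_smul, hl₂.neg_pow]
    simp only [hφ_def, hv]
    rw [inner_twoShellL_self hd₁ hd₂ hY₁ hY₂ hH₁ hH₂, inner_twoShellL_self hd₁ hd₂ hY₁ hY₂ hH₁ hH₂, hn1, hn2, hY₁s, hY₂s, hY₁n, hY₂n]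
    have hden : 2 * ((l₁ : ℝ) * ((l₁ : ℝ) + 1)) * s ^ l₁ * Y₁ e ≠ 0 :=
      mul_ne_zero (mul_ne_zero (mul_ne_zero two_ne_zero hc) (pow_ne_zero _ hs0.ne')) hYe
    field_simp
    ring
  refine AnalyticAt.congr ?_ hev
  exact (hφ r).div (((analyticAt_const.mul (analyticAt_id.pow l₁)).mul analyticAt_const))
    (mul_ne_zero (mul_ne_zero (mul_ne_zero two_ne_zero hc) (pow_ne_zero _ hr0.ne')) hYe)

/-- ★ THE EVEN-DEGREE PROFILE OF AN ANALYTIC TWO-SHELL OF OPPOSITE PARITY IS ANALYTIC on `(0,∞)` (the even part of the read-off). -/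
theorem analyticOnNhd_twoShellProfile_even (hl₁ : Odd l₁) (hl₂ : Even l₂) (hd₁ : 1 ≤ l₁) (hd₂ : 1 ≤ l₂)
    (hY₁ : IsSolidHarmonic l₁ Y₁) (hY₂ : IsSolidHarmonic l₂ Y₂) (hY₂ne : ∃ y, Y₂ y ≠ 0)
    (hH₁ : VirialAdmissible l₁ H₁) (hH₂ : VirialAdmissible l₂ H₂)
    (hu : AnalyticOnNhd ℝ (twoShellL H₁ H₂ Y₁ Y₂ x₀) univ) : AnalyticOnNhd ℝ H₂ (Ioi 0) := by
  obtain ⟨e, he, hYe⟩ := exists_unit_ne_zero hd₂ hY₂ hY₂ne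
  set v : E3 → E3 := twoShellL H₁ H₂ Y₁ Y₂ x₀ with hv
  set φ : ℝ → ℝ := fun r => inner ℝ (v (x₀ + r • e)) (r • e) + inner ℝ (v (x₀ + (-r) • e)) ((-r) • e) with hφ_def
  have hφ : ∀ r : ℝ, AnalyticAt ℝ φ r := fun r =>
    (analyticAt_rayReadOff hu x₀ e r).add ((analyticAt_rayReadOff hu x₀ e (-r)).comp analyticAt_id.neg)
  have hc : ((l₂ : ℝ) * ((l₂ : ℝ) + 1)) ≠ 0 := by positivity
  intro r hr
  have hr0 : (0 : ℝ) < r := hr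
  have hev : (fun s : ℝ => φ s / (2 * ((l₂ : ℝ) * ((l₂ : ℝ) + 1)) * s ^ l₂ * Y₂ e)) =ᶠ[𝓝 r] H₂ := by
    filter_upwards [Ioi_mem_nhds hr0] with s hs
    have hs0 : (0 : ℝ) < s := hs
    have hn1 : ‖s • e‖ = s := by rw [norm_smul, Real.norm_of_nonneg hs0.le, he, mul_one]
    have hn2 : ‖(-s) • e‖ = s := by rw [norm_smul, Real.norm_eq_abs, abs_neg, abs_of_pos hs0, he, mul_one]
    have hY₁s : Y₁ (s • e) = s ^ l₁ * Y₁ e := hY₁.apply_smul s e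
    have hY₂s : Y₂ (s • e) = s ^ l₂ * Y₂ e := hY₂.apply_smul s e
    have hY₁n : Y₁ ((-s) • e) = -(s ^ l₁ * Y₁ e) := by rw [hY₁.apply_smul, hl₁.neg_pow, neg_mul]
    have hY₂n : Y₂ ((-s) • e) = s ^ l₂ * Y₂ e := by rw [hY₂.apply_smul, hl₂.neg_pow]
    simp only [hφ_def, hv]
    rw [inner_twoShellL_self hd₁ hd₂ hY₁ hY₂ hH₁ hH₂, inner_twoShellL_self hd₁ hd₂ hY₁ hY₂ hH₁ hH₂, hn1, hn2, hY₁s, hY₂s, hY₁n, hY₂n]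
    have hden : 2 * ((l₂ : ℝ) * ((l₂ : ℝ) + 1)) * s ^ l₂ * Y₂ e ≠ 0 :=
      mul_ne_zero (mul_ne_zero (mul_ne_zero two_ne_zero hc) (pow_ne_zero _ hs0.ne')) hYe
    field_simp
    ring
  refine AnalyticAt.congr ?_ hev
  exact (hφ r).div (((analyticAt_const.mul (analyticAt_id.pow l₂)).mul analyticAt_const))
    (mul_ne_zero (mul_ne_zero (mul_ne_zero two_ne_zero hc) (pow_ne_zero _ hr0.ne')) hYe)

end ReadOff

/-! ## §2 ★ Two-shell windows of opposite parity with a degree gap vanish -/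

variable {S : Set ℝ} {u : ℝ → E3 → E3} {x₀ : E3}

/-- ★ **TWO-SHELL WINDOWS OF OPPOSITE PARITY WITH `|l₁ − l₂| ≥ 2` VANISH** (`l₁` odd, `l₂` even, either order of size; module docstring). -/
theorem twoShell_window_vanishes_of_gap (hS : IsOpen S) (hcont : ContinuousOn (uncurry u) (S ×ˢ univ))
    (hdiv : ∀ t ∈ S, VectorCalculus.IsDivFree (u t))
    (hmild : ∀ s ∈ S, ∀ t ∈ S, s < t → ∀ x, u t x = heatExtension (u s) (t - s) x - oseenDuhamel 1 s u u t x)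
    (hbdd : ∀ τ ∈ S, ∃ B : ℝ, ∀ t ∈ S, t ≤ τ → ∀ x, ‖u t x‖ ≤ B)
    {l₁ l₂ : ℕ} (hl₁ : Odd l₁) (hl₂ : Even l₂) (hd₁ : 1 ≤ l₁) (hd₂ : 1 ≤ l₂) (hgap : l₁ + 2 ≤ l₂ ∨ l₂ + 2 ≤ l₁)
    {Y₁ Y₂ : E3 → ℝ} (hY₁ : IsSolidHarmonic l₁ Y₁) (hY₂ : IsSolidHarmonic l₂ Y₂) (hY₁ne : ∃ y, Y₁ y ≠ 0) (hY₂ne : ∃ y, Y₂ y ≠ 0)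
    {H₁f H₂f : ℝ → ℝ → ℝ} (hH₁ : ∀ t ∈ S, VirialAdmissible l₁ (H₁f t)) (hH₂ : ∀ t ∈ S, VirialAdmissible l₂ (H₂f t))
    (hshape : ∀ t ∈ S, u t = twoShellL (H₁f t) (H₂f t) Y₁ Y₂ x₀) :
    ∀ t ∈ S, ∀ x, u t x = 0 := by
  -- at each time: balance, sphere relation
  have hsphere : ∀ t ∈ S, ∀ r : ℝ, 0 < r → ∃ e C : ℝ, ∀ w : E3, ‖w‖ = 1 →
      -(vortAmpL l₁ (H₁f t) r * strainAmpL l₁ (H₁f t) r) * (r ^ ((l₁ : ℤ) - 1)) ^ 2 * ‖gradient Y₁ w‖ ^ 2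
        + (l₁ : ℝ) / (2 * r) * (((l₁ : ℝ) - 1) * vortAmpL l₁ (H₁f t) r * deriv (H₁f t) r
            - ((l₁ : ℝ) + 1) * deriv (vortAmpL l₁ (H₁f t)) r * H₁f t r) * (r ^ l₁) ^ 2 * Y₁ w ^ 2
        + (-(vortAmpL l₂ (H₂f t) r * strainAmpL l₂ (H₂f t) r) * (r ^ ((l₂ : ℤ) - 1)) ^ 2 * ‖gradient Y₂ w‖ ^ 2
          + (l₂ : ℝ) / (2 * r) * (((l₂ : ℝ) - 1) * vortAmpL l₂ (H₂f t) r * deriv (H₂f t) r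
              - ((l₂ : ℝ) + 1) * deriv (vortAmpL l₂ (H₂f t)) r * H₂f t r) * (r ^ l₂) ^ 2 * Y₂ w ^ 2)
        - e * r ^ l₂ * Y₂ w = C := by
    intro t ht r hr
    have hbal := twoShell_window_toroidal_balance hS hcont hdiv hmild hbdd hl₁ hl₂ hY₁ hY₂ hH₁ hH₂ hshape ht
    rw [hshape t ht] at hbal
    exact twoShell_sphere_relation hl₁ hl₂ hd₁ hd₂ hY₁ hY₂ (hH₁ t ht) (hH₂ t ht) x₀ hbal hr
  have han : ∀ t ∈ S, AnalyticOnNhd ℝ (twoShellL (H₁f t) (H₂f t) Y₁ Y₂ x₀) univ := fun t ht => by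
    rw [← hshape t ht]; exact window_analyticOnNhd_slice hS hcont hmild hbdd ht
  rcases hgap with h12 | h21
  · -- the TOP shell is the even one (degree `l₂ ≥ l₁ + 2`): `H₂ ≡ 0`, the slices are single shells of degree `l₁`
    have hH₂null : ∀ t ∈ S, ∀ r : ℝ, 0 < r → H₂f t r = 0 := by
      intro t ht
      refine amplitudeVanishing l₂ (H₂f t) hd₂ (hH₂ t ht)
        (analyticOnNhd_twoShellProfile_even hl₁ hl₂ hd₁ hd₂ hY₁ hY₂ hY₂ne (hH₁ t ht) (hH₂ t ht) (han t ht)) ?_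
      intro r hr
      obtain ⟨e, C, hrel⟩ := hsphere t ht r hr
      have hcoef := twoShell_sphere_coefficients (Y_T := Y₂) (Y_B := Y₁) hd₁ (by omega) hY₂ hY₁ hY₂ne
        (A_T := -(vortAmpL l₂ (H₂f t) r * strainAmpL l₂ (H₂f t) r) * (r ^ ((l₂ : ℤ) - 1)) ^ 2)
        (B_T := (l₂ : ℝ) / (2 * r) * (((l₂ : ℝ) - 1) * vortAmpL l₂ (H₂f t) r * deriv (H₂f t) r
            - ((l₂ : ℝ) + 1) * deriv (vortAmpL l₂ (H₂f t)) r * H₂f t r) * (r ^ l₂) ^ 2)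
        (A_B := -(vortAmpL l₁ (H₁f t) r * strainAmpL l₁ (H₁f t) r) * (r ^ ((l₁ : ℤ) - 1)) ^ 2)
        (B_B := (l₁ : ℝ) / (2 * r) * (((l₁ : ℝ) - 1) * vortAmpL l₁ (H₁f t) r * deriv (H₁f t) r
            - ((l₁ : ℝ) + 1) * deriv (vortAmpL l₁ (H₁f t)) r * H₁f t r) * (r ^ l₁) ^ 2)
        (E_T := -(e * r ^ l₂)) (E_B := 0) (C₀ := C) (Or.inr hl₂) (Or.inl rfl)
        (fun w hw => by have h := hrel w hw; linear_combination h)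
      have hA := hcoef.2 h12
      have hpow : (r ^ ((l₂ : ℤ) - 1)) ^ 2 ≠ 0 := pow_ne_zero 2 (zpow_ne_zero _ hr.ne')
      have h1 : vortAmpL l₂ (H₂f t) r * strainAmpL l₂ (H₂f t) r * (r ^ ((l₂ : ℤ) - 1)) ^ 2 = 0 := by linear_combination -hA
      exact (mul_eq_zero.mp h1).resolve_right hpow
    have hshape' : ∀ t ∈ S, u t = sepShellL (H₁f t) Y₁ x₀ := by
      intro t ht
      rw [hshape t ht]
      funext x
      show sepShellL (H₁f t) Y₁ x₀ x + sepShellL (H₂f t) Y₂ x₀ x = _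
      rw [sepShellL_null_of_pos (H₂f t) Y₂ x₀ (hH₂null t ht) x, add_zero]
    exact singleShellWindowVanishes l₁ hd₁ S hS u x₀ hcont hdiv hmild hbdd Y₁ H₁f hY₁ hY₁ne hH₁ hshape'
  · -- the TOP shell is the odd one (degree `l₁ ≥ l₂ + 2`): `H₁ ≡ 0`, the slices are single shells of degree `l₂`
    have hH₁null : ∀ t ∈ S, ∀ r : ℝ, 0 < r → H₁f t r = 0 := by
      intro t ht
      refine amplitudeVanishing l₁ (H₁f t) hd₁ (hH₁ t ht)
        (analyticOnNhd_twoShellProfile_odd hl₁ hl₂ hd₁ hd₂ hY₁ hY₂ hY₁ne (hH₁ t ht) (hH₂ t ht) (han t ht)) ?_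
      intro r hr
      obtain ⟨e, C, hrel⟩ := hsphere t ht r hr
      have hcoef := twoShell_sphere_coefficients (Y_T := Y₁) (Y_B := Y₂) hd₂ (by omega) hY₁ hY₂ hY₁ne
        (A_T := -(vortAmpL l₁ (H₁f t) r * strainAmpL l₁ (H₁f t) r) * (r ^ ((l₁ : ℤ) - 1)) ^ 2)
        (B_T := (l₁ : ℝ) / (2 * r) * (((l₁ : ℝ) - 1) * vortAmpL l₁ (H₁f t) r * deriv (H₁f t) r
            - ((l₁ : ℝ) + 1) * deriv (vortAmpL l₁ (H₁f t)) r * H₁f t r) * (r ^ l₁) ^ 2)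
        (A_B := -(vortAmpL l₂ (H₂f t) r * strainAmpL l₂ (H₂f t) r) * (r ^ ((l₂ : ℤ) - 1)) ^ 2)
        (B_B := (l₂ : ℝ) / (2 * r) * (((l₂ : ℝ) - 1) * vortAmpL l₂ (H₂f t) r * deriv (H₂f t) r
            - ((l₂ : ℝ) + 1) * deriv (vortAmpL l₂ (H₂f t)) r * H₂f t r) * (r ^ l₂) ^ 2)
        (E_T := 0) (E_B := -(e * r ^ l₂)) (C₀ := C) (Or.inl rfl) (Or.inr hl₂)
        (fun w hw => by have h := hrel w hw; linear_combination h)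
      have hA := hcoef.2 h21
      have hpow : (r ^ ((l₁ : ℤ) - 1)) ^ 2 ≠ 0 := pow_ne_zero 2 (zpow_ne_zero _ hr.ne')
      have h1 : vortAmpL l₁ (H₁f t) r * strainAmpL l₁ (H₁f t) r * (r ^ ((l₁ : ℤ) - 1)) ^ 2 = 0 := by linear_combination -hA
      exact (mul_eq_zero.mp h1).resolve_right hpow
    have hshape' : ∀ t ∈ S, u t = sepShellL (H₂f t) Y₂ x₀ := by
      intro t ht
      rw [hshape t ht]
      funext x
      show sepShellL (H₁f t) Y₁ x₀ x + sepShellL (H₂f t) Y₂ x₀ x = _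
      rw [sepShellL_null_of_pos (H₁f t) Y₁ x₀ (hH₁null t ht) x, zero_add]
    exact singleShellWindowVanishes l₂ hd₂ S hS u x₀ hcont hdiv hmild hbdd Y₂ H₂f hY₂ hY₂ne hH₂ hshape'

/-! ## §3 ★★ The rungs -/

/-- ★★ **`TwoShellWindowRigidity l₁ l₂` FOR `l₁` ODD, `l₂` EVEN, `|l₁ − l₂| ≥ 2`**: such windows vanish, and the zero window is
infinitesimally axisymmetric. -/
theorem twoShellWindowRigidity_odd_even {l₁ l₂ : ℕ} (hl₁ : Odd l₁) (hl₂ : Even l₂) (hd₁ : 1 ≤ l₁) (hd₂ : 1 ≤ l₂)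
    (hgap : l₁ + 2 ≤ l₂ ∨ l₂ + 2 ≤ l₁) : TwoShellWindowRigidity l₁ l₂ := by
  intro S hS _ u x₀ hcont hdiv hmild hbdd _ Y₁ Y₂ H₁f H₂f hY₁ hY₂ hY₁ne hY₂ne hH₁ hH₂ hshape
  have hzero := twoShell_window_vanishes_of_gap hS hcont hdiv hmild hbdd hl₁ hl₂ hd₁ hd₂ hgap hY₁ hY₂ hY₁ne hY₂ne hH₁ hH₂ hshape
  obtain ⟨A, hskew, hA0⟩ := exists_skew_ne_zero
  refine ⟨A, hskew, hA0, fun t ht x => ?_⟩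
  have hut : u t = fun _ => (0 : E3) := funext (hzero t ht)
  rw [hut]
  simp

/-- ★★ **`TwoShellWindowRigidity l₁ l₂` FOR EVERY OPPOSITE-PARITY PAIR WITH `|l₁ − l₂| ≥ 2`** (the `(even, odd)` order by swapping the
two shells, `twoShellL H₁ H₂ Y₁ Y₂ = twoShellL H₂ H₁ Y₂ Y₁`). -/
theorem twoShellWindowRigidity_of_gap {l₁ l₂ : ℕ} (hd₁ : 1 ≤ l₁) (hd₂ : 1 ≤ l₂)
    (hpar : (Odd l₁ ∧ Even l₂) ∨ (Even l₁ ∧ Odd l₂)) (hgap : l₁ + 2 ≤ l₂ ∨ l₂ + 2 ≤ l₁) :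
    TwoShellWindowRigidity l₁ l₂ := by
  rcases hpar with ⟨h1, h2⟩ | ⟨h1, h2⟩
  · exact twoShellWindowRigidity_odd_even h1 h2 hd₁ hd₂ hgap
  · intro S hS hconn u x₀ hcont hdiv hmild hbdd hunth Y₁ Y₂ H₁f H₂f hY₁ hY₂ hY₁ne hY₂ne hH₁ hH₂ hshape
    refine twoShellWindowRigidity_odd_even h2 h1 hd₂ hd₁ (hgap.symm) S hS hconn u x₀ hcont hdiv hmild hbdd hunth Y₂ Y₁ H₂f H₁f
      hY₂ hY₁ hY₂ne hY₁ne hH₂ hH₁ fun t ht => ?_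
    rw [hshape t ht]
    funext x
    simp only [twoShellL]
    rw [add_comm]

/-- the residual R of LINE g12-1 at these degree pairs holds a fortiori. -/
theorem linkedPairWindowRigidity_of_gap {l₁ l₂ : ℕ} (hd₁ : 1 ≤ l₁) (hd₂ : 1 ≤ l₂)
    (hpar : (Odd l₁ ∧ Even l₂) ∨ (Even l₁ ∧ Odd l₂)) (hgap : l₁ + 2 ≤ l₂ ∨ l₂ + 2 ≤ l₁) :
    LinkedPairWindowRigidity l₁ l₂ :=
  fun S hS hc u x₀ h1 h2 h3 h4 h5 Y₁ Y₂ H₁f H₂f hY₁ hY₂ hn₁ hn₂ _ hH₁ hH₂ hsh _ =>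
    twoShellWindowRigidity_of_gap hd₁ hd₂ hpar hgap S hS hc u x₀ h1 h2 h3 h4 h5 Y₁ Y₂ H₁f H₂f hY₁ hY₂ hn₁ hn₂ hH₁ hH₂ hsh

/-- by name: `(1,4)`. -/
theorem twoShellWindowRigidity_one_four : TwoShellWindowRigidity 1 4 :=
  twoShellWindowRigidity_of_gap le_rfl (by norm_num) (Or.inl ⟨odd_one, by decide⟩) (Or.inl (by norm_num))

/-- by name: `(4,1)`. -/
theorem twoShellWindowRigidity_four_one : TwoShellWindowRigidity 4 1 :=
  twoShellWindowRigidity_of_gap (by norm_num) le_rfl (Or.inr ⟨by decide, odd_one⟩) (Or.inr (by norm_num))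

/-- by name: `(1,6)`. -/
theorem twoShellWindowRigidity_one_six : TwoShellWindowRigidity 1 6 :=
  twoShellWindowRigidity_of_gap le_rfl (by norm_num) (Or.inl ⟨odd_one, by decide⟩) (Or.inl (by norm_num))

/-- by name: `(2,5)`. -/
theorem twoShellWindowRigidity_two_five : TwoShellWindowRigidity 2 5 :=
  twoShellWindowRigidity_of_gap (by norm_num) (by norm_num) (Or.inr ⟨by decide, by decide⟩) (Or.inl (by norm_num))

/-- by name: `(3,6)`. -/
theorem twoShellWindowRigidity_three_six : TwoShellWindowRigidity 3 6 :=
  twoShellWindowRigidity_of_gap (by norm_num) (by norm_num) (Or.inl ⟨by decide, by decide⟩) (Or.inl (by norm_num))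

end Summit.NavierStokesRegularity.NavierStokesRegularity.Theorems.UnthreadedRigidity.MixedPair

end
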